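import Summits.QuantumFields.YangMills.Theorems.UnitScaleTiltHalvingEffGaugeStepBlockMean
import Literature.MathematicalPhysics.QuantumFieldTheory.Balaban1983to89.B7Eq84Concrete
import HarnessLib

/-!
# Line H (`BirthV10.stub_halvingStep`, stmt-QuantumFields-19200) — (M2′) (b)-row, (B-al-4)₃ UNITARY LETTERS: the corner-based averaged gauge `R̄ʲu = uavg L 1 u j` as
# `v·exp[mean log]`, its unitarity on the pyramid's boxes from the ω-row, the oscillation and base-change rows of the reference family, and the effective gauge's
# one-step unitarity transfer

Cell `ym3-torus` (HUMAN RULING D-0037: YM₃ on T³ is ladder rung R3 — NOT d = 4, NOT infinite volume, NOT a mass gap, NOT the Clay problem), width seat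
`ym-ust-20520-w4` gen 11 (fallback pen of (B-al-4)₃; ★w3-20520 g9 `HANDOFF-w3-20520-g9.md` (P5)–(P8)).  `--supports stmt-QuantumFields-19200 --as helper`; THEOREMS ONLY
(0 `def`, 0 `sorry`); count-neutral; nothing here claims (B-al-4)₃, the (b)-row, (M2′), the stub, the crux or the gap.

WHAT.
* §1 `val_uavg_one_succ` — lit's (78)∕(80) at `U₀ = 1` in the `exp[mean log]` letter: `R̄^{j+1}u(w) = R̄ʲu(Lw)·eml{R̄ʲu(Lw)⁻¹R̄ʲu(Lw + r)}_{r ∈ [0,L)ᵈ}` (✓`uavg_succ_one_left`,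
  ✓`val_savg`, ✓`eml_eq_exp_sum`); `eml_const`.
* §2 ★`uavg_one_mem_unitaryUnits` — (P7): along any descending family of label predicates `Q_j` closed under «block of a `Q_{j+1}`-label ⊂ `Q_j`», if `u` is unitary and the
  in-block oscillation of `R̄ʲu` on the `Q_{j+1}`-blocks is `≤ 1∕3` (the ω-row), then `R̄ʲu` is unitary on `Q_j` for every `j ≤ k` (✓`eml_mem_unitaryGroup`: the mean of
  skew-Hermitian logarithms is skew-Hermitian).
* §3 (P5) ★`norm_ratio_conj_sub_one_le` — `‖(vh)(vg)⁻¹ − 1‖ ≤ ‖h − 1‖ + ‖g − 1‖` for unitaries (the reference family's centre∕stair-end oscillation `e_j := 3ω_j`);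
  (P6) ★★`norm_href_sub_one_le` — the CORNER↔CENTRE base change of the block average: with `V₁ = v·eml{g_r}`, `‖V₁(vh)⁻¹·eml{(vh)(vg_{i.1})⁻¹}_{i ∈ Idx} − 1‖ ≤ 1024ω²`
  (`‖h − 1‖, ‖g_r − 1‖ ≤ ω ≤ 1∕32`; ✓`HalvingEffGaugeStepBlockMean.norm_eml_mul_sub_mul_le` with the constant family `h`, ✓`eml_mul_inv`, unitary conjugation) — `τ_j := 1200ω_j²`.
* §4 (P8) ★`effGaugeStep_mem_unitaryUnits` — the effective-gauge step `κ′(y) = v(Y^κ)(y)⁻¹κ(ŷ)v(Y)(y)` is unitary when `κ` is unitary at the block centre and the stair ends with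
  oscillation `≤ 1∕4` there and the centre stairs of `Y` are unitary within `1∕64` of `1` (✓`coe_vframeU`, ✓`coe_vframeU_gaugeActT_eq_conj_eml`, ✓`eml_mem_unitaryGroup`).
HONEST SCOPE.  Elementary `C⋆`∕matrix bookkeeping over the tree's `exp[mean log]` letters; no new analysis.

References: T. Bałaban, CMP **98** (1985) 17–51 [Balaban1985Averaging] ((78)–(80) p.30, (97)–(100) p.32, (110) p.34); CMP **109** (1987) 249–301 [Balaban1987RG1]
((0.4)–(0.9) p.253).
-/

set_option autoImplicit false

noncomputable section

open scoped BigOperators Matrix.Norms.L2Operator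
open NormedSpace

namespace Summit.QuantumFields.YangMills.Theorems.HalvingEffGaugeRowGUnitary

open Literature.MathematicalPhysics.QuantumFieldTheory.Balaban1983to89
open T4Continuum (walkEnd stairWord)
open BlockAveraging (Idx off)
open ExpMeanLog (eml eml_eq_exp eml_eq_exp_sum eml_conj eml_mul_inv eml_mem_unitaryGroup norm_star_sub_one norm_conj_sub_one_eq)
open MatrixLog (mlog exp_mlog)
open B7Prop1Explicit (boxVec)
open B7Prop2Explicit (unitaryUnits)
open B7Eq84Concrete (uavg uavg_zero uavg_succ_one_left)
open B7Eq99Concrete (val_savg)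
open B10Eq27TorusAxialLog (holT gaugeActT)
open Summit.QuantumFields.YangMills.Theorems.Prop8ChartDoubleBar (vframeU coe_vframeU)
open Summit.QuantumFields.YangMills.Theorems.HalvingEffGaugeStepBlockMean (norm_eml_mul_sub_mul_le coe_vframeU_gaugeActT_eq_conj_eml)

/-! ## §1 The corner-based averaged gauge at `U₀ = 1` in the `exp[mean log]` letter -/

section Dictionary

variable {d : ℕ} {𝔸 : Type*} [NormedRing 𝔸] [NormedAlgebra ℂ 𝔸] [CompleteSpace 𝔸]

/-- ★ **(80) AT `U₀ = 1` IN THE `exp[mean log]` LETTER**: `R̄^{j+1}u(w) = R̄ʲu(L·w) · eml{ R̄ʲu(L·w)⁻¹·R̄ʲu(L·w + r) }_{r ∈ [0,L)ᵈ}` — lit's site average (78)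
`{g(x)}_{x ∈ B(y)} = g(y)·exp[Σ_{x∈B(y)} L^{−d} log g(y)⁻¹g(x)]` with the uniform weights `L^{−d} = |[0,L)ᵈ|⁻¹`. [cite: Balaban1985Averaging, (78)-(80) p.30] -/
theorem val_uavg_one_succ (L : ℕ) (u : B7Prop1Explicit.Site d → 𝔸ˣ) (j : ℕ) (w : B7Prop1Explicit.Site d) :
    ((uavg L (1 : B7Prop1Explicit.Site d → Fin d → 𝔸ˣ) u (j + 1) w : 𝔸ˣ) : 𝔸) =
      ((uavg L (1 : B7Prop1Explicit.Site d → Fin d → 𝔸ˣ) u j ((L : ℤ) • w) : 𝔸ˣ) : 𝔸) *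
        eml (fun r : Fin d → Fin L =>
          ((((uavg L (1 : B7Prop1Explicit.Site d → Fin d → 𝔸ˣ) u j ((L : ℤ) • w))⁻¹ *
              uavg L (1 : B7Prop1Explicit.Site d → Fin d → 𝔸ˣ) u j ((L : ℤ) • w + boxVec L r) : 𝔸ˣ)) : 𝔸)) := by
  rw [uavg_succ_one_left, val_savg, eml_eq_exp_sum, Fintype.card_fun, Fintype.card_fin, Fintype.card_fin, Nat.cast_pow]

/-- `exp[mean log]` of a constant family is the constant, on `‖x − 1‖ < 1` (`e^{log x} = x`). [folklore] -/
theorem eml_const {ι : Type*} [Fintype ι] [Nonempty ι] {x : 𝔸} (hx : ‖x - 1‖ < 1) : eml (fun _ : ι => x) = x := by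
  rw [eml_eq_exp, Finset.sum_const, Finset.card_univ, ← Nat.cast_smul_eq_nsmul ℂ, smul_smul,
    inv_mul_cancel₀ (Nat.cast_ne_zero.2 Fintype.card_ne_zero), one_smul, exp_mlog hx]

omit [NormedAlgebra ℂ 𝔸] [CompleteSpace 𝔸] in
/-- sup norm of a tuple from pointwise bounds (any index type). [folklore] -/
theorem pi_norm_sub_one_le' {ι : Type*} [Fintype ι] {F : ι → 𝔸} {r : ℝ} (hr : 0 ≤ r) (h : ∀ i, ‖F i - 1‖ ≤ r) : ‖F - 1‖ ≤ r :=
  (pi_norm_le_iff_of_nonneg hr).2 fun i => by simpa only [Pi.sub_apply, Pi.one_apply] using h i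

end Dictionary

/-! ## §2 Unitarity of `R̄ʲu` on the boxes, from the ω-row -/

section Unitary

variable {n : Type*} [Fintype n] [DecidableEq n]

/-- Membership of a unit of `M_n(ℂ)` in the unitary units is membership of its value in `U(n)`. [folklore] -/
theorem mem_unitaryUnits_iff (x : (Matrix n n ℂ)ˣ) : x ∈ unitaryUnits (Matrix n n ℂ) ↔ (x : Matrix n n ℂ) ∈ Matrix.unitaryGroup n ℂ := Iff.rfl

/-- `‖x⁻¹ − 1‖ = ‖x − 1‖` for a unitary unit (`x⁻¹ = x*`, ✓`norm_star_sub_one`). [folklore] -/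
theorem norm_inv_sub_one_of_mem_unitaryUnits {x : (Matrix n n ℂ)ˣ} (hx : x ∈ unitaryUnits (Matrix n n ℂ)) :
    ‖((x⁻¹ : (Matrix n n ℂ)ˣ) : Matrix n n ℂ) - 1‖ = ‖(x : Matrix n n ℂ) - 1‖ := by
  rw [Units.inv_eq_of_mul_eq_one_right (Unitary.mul_star_self_of_mem hx), norm_star_sub_one]

variable {d : ℕ}

/-- ★ **(P7) `R̄ʲu` IS UNITARY ON THE PYRAMID's BOXES.**  Let `Q_j` be label predicates with «`w ∈ Q_{j+1} ⇒ L·w + r ∈ Q_j` for `r ∈ [0,L)ᵈ`» (`j < k`), `u` unitary, and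
the in-block oscillation of `R̄ʲu = uavg L 1 u j` on the blocks of the `Q_{j+1}`-labels at most `1∕3` (the ω-row).  Then `R̄ʲu(w)` is unitary for `w ∈ Q_j`, `j ≤ k`:
`R̄^{j+1}u(w) = R̄ʲu(Lw)·eml{g_r}` with `g_r` unitary within `1∕3` of `1`, and ✓`eml_mem_unitaryGroup`. [cite: Balaban1985Averaging, (78)-(80) p.30; Balaban1987RG1, (0.9) p.253] -/
theorem uavg_one_mem_unitaryUnits [Nonempty n] {L : ℕ} (hL : 0 < L) (u : B7Prop1Explicit.Site d → (Matrix n n ℂ)ˣ)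
    (hu : ∀ z, u z ∈ unitaryUnits (Matrix n n ℂ)) (Q : ℕ → B7Prop1Explicit.Site d → Prop) {k : ℕ}
    (hQ : ∀ j, j < k → ∀ w, Q (j + 1) w → ∀ r : Fin d → Fin L, Q j ((L : ℤ) • w + boxVec L r))
    (hosc : ∀ j, j < k → ∀ w, Q (j + 1) w → ∀ r : Fin d → Fin L,
      ‖((((uavg L (1 : B7Prop1Explicit.Site d → Fin d → (Matrix n n ℂ)ˣ) u j ((L : ℤ) • w))⁻¹ *
            uavg L (1 : B7Prop1Explicit.Site d → Fin d → (Matrix n n ℂ)ˣ) u j ((L : ℤ) • w + boxVec L r) : (Matrix n n ℂ)ˣ)) : Matrix n n ℂ) - 1‖ ≤ 1 / 3) :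
    ∀ j, j ≤ k → ∀ w, Q j w → uavg L (1 : B7Prop1Explicit.Site d → Fin d → (Matrix n n ℂ)ˣ) u j w ∈ unitaryUnits (Matrix n n ℂ) := by
  intro j
  induction j with
  | zero => intro _ w _; rw [uavg_zero]; exact hu w
  | succ j ih =>
    intro hjk w hw
    have hj : j < k := Nat.lt_of_succ_le hjk
    have h0 : (L : ℤ) • w + boxVec L (fun _ => ⟨0, hL⟩) = (L : ℤ) • w := by
      funext i; simp [boxVec]
    have hv : uavg L (1 : B7Prop1Explicit.Site d → Fin d → (Matrix n n ℂ)ˣ) u j ((L : ℤ) • w) ∈ unitaryUnits (Matrix n n ℂ) := by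
      have h := ih hj.le _ (hQ j hj w hw (fun _ => ⟨0, hL⟩)); rwa [h0] at h
    have hg : ∀ r : Fin d → Fin L, ((uavg L (1 : B7Prop1Explicit.Site d → Fin d → (Matrix n n ℂ)ˣ) u j ((L : ℤ) • w))⁻¹ *
        uavg L (1 : B7Prop1Explicit.Site d → Fin d → (Matrix n n ℂ)ˣ) u j ((L : ℤ) • w + boxVec L r)) ∈ unitaryUnits (Matrix n n ℂ) :=
      fun r => (unitaryUnits _).mul_mem ((unitaryUnits _).inv_mem hv) (ih hj.le _ (hQ j hj w hw r))
    rw [mem_unitaryUnits_iff, val_uavg_one_succ]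
    exact Submonoid.mul_mem _ hv (eml_mem_unitaryGroup (fun r => hg r) (fun r => hosc j hj w hw r))

/-! ## §3 The oscillation and the base change of the reference family -/

/-- ★ **(P5) `‖(v·h)·(v·g)⁻¹ − 1‖ ≤ ‖h − 1‖ + ‖g − 1‖` FOR UNITARIES** (`(vh)(vg)⁻¹ = v(hg⁻¹)v⁻¹`, unitary conjugation is isometric on `· − 1`, `g⁻¹ = g*`).
[cite: Balaban1985Averaging, (97)-(100) p.32] -/
theorem norm_ratio_conj_sub_one_le [Nonempty n] {v g : (Matrix n n ℂ)ˣ} (h : (Matrix n n ℂ)ˣ) (hv : v ∈ unitaryUnits (Matrix n n ℂ))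
    (hg : g ∈ unitaryUnits (Matrix n n ℂ)) :
    ‖(((v * h) * (v * g)⁻¹ : (Matrix n n ℂ)ˣ) : Matrix n n ℂ) - 1‖ ≤ ‖(h : Matrix n n ℂ) - 1‖ + ‖(g : Matrix n n ℂ) - 1‖ := by
  have hvinv : ((v⁻¹ : (Matrix n n ℂ)ˣ) : Matrix n n ℂ) ∈ Matrix.unitaryGroup n ℂ := (unitaryUnits _).inv_mem hv
  have hginv : ((g⁻¹ : (Matrix n n ℂ)ˣ) : Matrix n n ℂ) ∈ Matrix.unitaryGroup n ℂ := (unitaryUnits _).inv_mem hg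
  have heq : (((v * h) * (v * g)⁻¹ : (Matrix n n ℂ)ˣ) : Matrix n n ℂ) = (v : Matrix n n ℂ) * (((h * g⁻¹ : (Matrix n n ℂ)ˣ)) : Matrix n n ℂ) * ((v⁻¹ : (Matrix n n ℂ)ˣ) : Matrix n n ℂ) := by
    rw [show (v * h) * (v * g)⁻¹ = v * (h * g⁻¹) * v⁻¹ by group]; simp only [Units.val_mul]
  rw [heq, norm_conj_sub_one_eq hv hvinv (by rw [← Units.val_mul, mul_inv_cancel, Units.val_one]), Units.val_mul]
  calc ‖(h : Matrix n n ℂ) * ((g⁻¹ : (Matrix n n ℂ)ˣ) : Matrix n n ℂ) - 1‖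
      = ‖((h : Matrix n n ℂ) - 1) * ((g⁻¹ : (Matrix n n ℂ)ˣ) : Matrix n n ℂ) + (((g⁻¹ : (Matrix n n ℂ)ˣ) : Matrix n n ℂ) - 1)‖ := by
          congr 1; noncomm_ring
    _ ≤ ‖(h : Matrix n n ℂ) - 1‖ * ‖((g⁻¹ : (Matrix n n ℂ)ˣ) : Matrix n n ℂ)‖ + ‖((g⁻¹ : (Matrix n n ℂ)ˣ) : Matrix n n ℂ) - 1‖ :=
          (norm_add_le _ _).trans (add_le_add (norm_mul_le _ _) le_rfl)
    _ = ‖(h : Matrix n n ℂ) - 1‖ + ‖(g : Matrix n n ℂ) - 1‖ := by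
          rw [CStarRing.norm_of_mem_unitary ((unitaryUnits _).inv_mem hg), mul_one, norm_inv_sub_one_of_mem_unitaryUnits hg]

/-- ★★ **(P6) THE CORNER↔CENTRE BASE CHANGE OF THE BLOCK AVERAGE.**  For unitaries `v, h, g_r` (`r ∈ [0,L)ᵈ`) with `‖h − 1‖, ‖g_r − 1‖ ≤ ω ≤ 1∕32` and `V₁ := v·eml{g_r}`
(the corner-based average (78) of the next level), the reference family's `href` product over the stair index,
`V₁·(vh)⁻¹ · eml{ (vh)·(v g_{i.1})⁻¹ }_{i ∈ Idx}`, is within `1024·ω²` of `1`: `eml` over `Idx` is `eml` over `[0,L)ᵈ` of `v(h g_r⁻¹)v⁻¹` (`hidx`), conjugation comes out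
(✓`eml_conj`), and `eml{h·g_r⁻¹} = h·eml{g_r⁻¹} + O(1024‖h−1‖·ω)` (✓`norm_eml_mul_sub_mul_le`, `eml_const`) with `eml{g_r}·eml{g_r⁻¹} = 1` (✓`eml_mul_inv`).
[cite: Balaban1985Averaging, (78)-(80) p.30, (97)-(100) p.32; Balaban1987RG1, (0.5)-(0.8) p.253] -/
theorem norm_href_sub_one_le [Nonempty n] {P : Params} (V₁ v h : (Matrix n n ℂ)ˣ) (g : (Fin P.d → Fin P.L) → (Matrix n n ℂ)ˣ)
    (hV₁ : (V₁ : Matrix n n ℂ) = (v : Matrix n n ℂ) * eml (fun r => ((g r : (Matrix n n ℂ)ˣ) : Matrix n n ℂ)))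
    (hv : v ∈ unitaryUnits (Matrix n n ℂ)) (hh : h ∈ unitaryUnits (Matrix n n ℂ)) (hg : ∀ r, g r ∈ unitaryUnits (Matrix n n ℂ))
    {ω : ℝ} (hω0 : 0 ≤ ω) (hω : ω ≤ 1 / 32) (hh1 : ‖(h : Matrix n n ℂ) - 1‖ ≤ ω) (hg1 : ∀ r, ‖(g r : Matrix n n ℂ) - 1‖ ≤ ω)
    (hidx : eml (fun i : Idx P => ((((v * h) * (v * g i.1)⁻¹ : (Matrix n n ℂ)ˣ)) : Matrix n n ℂ)) =
      eml (fun r : Fin P.d → Fin P.L => ((((v * h) * (v * g r)⁻¹ : (Matrix n n ℂ)ˣ)) : Matrix n n ℂ))) :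
    ‖((V₁ * (v * h)⁻¹ : (Matrix n n ℂ)ˣ) : Matrix n n ℂ) * eml (fun i : Idx P => ((((v * h) * (v * g i.1)⁻¹ : (Matrix n n ℂ)ˣ)) : Matrix n n ℂ)) - 1‖
      ≤ 1024 * ω ^ 2 := by
  have hP : Nonempty (Fin P.d → Fin P.L) := ⟨fun _ => ⟨0, P.L_pos⟩⟩
  -- letters
  set vM : Matrix n n ℂ := (v : Matrix n n ℂ) with hvM
  set viM : Matrix n n ℂ := ((v⁻¹ : (Matrix n n ℂ)ˣ) : Matrix n n ℂ) with hviM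
  set hM : Matrix n n ℂ := (h : Matrix n n ℂ) with hhM
  set hiM : Matrix n n ℂ := ((h⁻¹ : (Matrix n n ℂ)ˣ) : Matrix n n ℂ) with hhiM
  set G : (Fin P.d → Fin P.L) → Matrix n n ℂ := fun r => ((g r : (Matrix n n ℂ)ˣ) : Matrix n n ℂ) with hG
  set Gi : (Fin P.d → Fin P.L) → Matrix n n ℂ := fun r => (((g r)⁻¹ : (Matrix n n ℂ)ˣ) : Matrix n n ℂ) with hGi
  have hvv : vM * viM = 1 := by rw [hvM, hviM, ← Units.val_mul, mul_inv_cancel, Units.val_one]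
  have hvv' : viM * vM = 1 := by rw [hvM, hviM, ← Units.val_mul, inv_mul_cancel, Units.val_one]
  have hhh : hiM * hM = 1 := by rw [hhM, hhiM, ← Units.val_mul, inv_mul_cancel, Units.val_one]
  have hvu : vM ∈ Matrix.unitaryGroup n ℂ := hv
  have hviu : viM ∈ Matrix.unitaryGroup n ℂ := (unitaryUnits _).inv_mem hv
  -- the Idx family is the conjugate family
  have hfam : (fun r : Fin P.d → Fin P.L => ((((v * h) * (v * g r)⁻¹ : (Matrix n n ℂ)ˣ)) : Matrix n n ℂ)) = fun r => vM * (hM * Gi r) * viM := by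
    funext r
    rw [show (v * h) * (v * g r)⁻¹ = v * (h * (g r)⁻¹) * v⁻¹ by group]
    simp only [Units.val_mul, hvM, hhM, hGi, hviM]
  have hconj : eml (fun i : Idx P => ((((v * h) * (v * g i.1)⁻¹ : (Matrix n n ℂ)ˣ)) : Matrix n n ℂ)) = vM * eml (fun r => hM * Gi r) * viM := by
    rw [hidx, hfam, eml_conj hvv hvv']
  -- the product, conjugated
  have hprod : ((V₁ * (v * h)⁻¹ : (Matrix n n ℂ)ˣ) : Matrix n n ℂ) * eml (fun i : Idx P => ((((v * h) * (v * g i.1)⁻¹ : (Matrix n n ℂ)ˣ)) : Matrix n n ℂ)) =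
      vM * (eml G * hiM * eml (fun r => hM * Gi r)) * viM := by
    rw [hconj, Units.val_mul, hV₁, mul_inv_rev, Units.val_mul]
    simp only [← hviM, ← hhiM]
    calc vM * eml G * (hiM * viM) * (vM * eml (fun r => hM * Gi r) * viM)
        = vM * eml G * hiM * (viM * vM) * eml (fun r => hM * Gi r) * viM := by noncomm_ring
      _ = vM * (eml G * hiM * eml (fun r => hM * Gi r)) * viM := by rw [hvv']; noncomm_ring
  rw [hprod, norm_conj_sub_one_eq hvu hviu hvv]
  -- sizes
  have hGu : ∀ r, G r ∈ Matrix.unitaryGroup n ℂ := fun r => hg r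
  have hGiu : ∀ r, Gi r ∈ Matrix.unitaryGroup n ℂ := fun r => (unitaryUnits _).inv_mem (hg r)
  have hG1 : ∀ r, ‖G r - 1‖ ≤ 1 / 3 := fun r => (hg1 r).trans (hω.trans (by norm_num))
  have hGi1 : ∀ r, ‖Gi r - 1‖ ≤ ω := fun r => by rw [hGi]; dsimp only; rw [norm_inv_sub_one_of_mem_unitaryUnits (hg r)]; exact hg1 r
  have hemlG : eml G ∈ Matrix.unitaryGroup n ℂ := eml_mem_unitaryGroup hGu hG1
  have hGG : eml G * eml Gi = 1 :=
    eml_mul_inv (fun r => by rw [hG, hGi]; dsimp only; rw [← Units.val_mul, mul_inv_cancel, Units.val_one]) hG1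
  -- `eml{h·Gi} = h·eml{Gi} + R`
  have hH1 : ‖(fun _ : Fin P.d → Fin P.L => hM) - 1‖ ≤ ω := pi_norm_sub_one_le' hω0 fun _ => hh1
  have hD1 : ‖Gi - 1‖ ≤ ω := pi_norm_sub_one_le' hω0 hGi1
  have hR := norm_eml_mul_sub_mul_le (ι := Fin P.d → Fin P.L) (H := fun _ => hM) (D := Gi) (hH1.trans hω) (hD1.trans (hω.trans (by norm_num)))
  have hmulfam : ((fun _ : Fin P.d → Fin P.L => hM) * Gi) = fun r => hM * Gi r := by funext r; rfl
  rw [hmulfam, eml_const (hh1.trans_lt (hω.trans_lt (by norm_num)))] at hR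
  -- assemble: `eml G · h⁻¹ · eml{h Gi} − 1 = eml G · h⁻¹ · (eml{h Gi} − h·eml Gi)`
  have hkey : eml G * hiM * eml (fun r => hM * Gi r) - 1 = eml G * hiM * (eml (fun r => hM * Gi r) - hM * eml Gi) := by
    rw [mul_sub, show eml G * hiM * (hM * eml Gi) = eml G * (hiM * hM) * eml Gi by noncomm_ring, hhh, mul_one, hGG]
  rw [hkey]
  calc ‖eml G * hiM * (eml (fun r => hM * Gi r) - hM * eml Gi)‖
      ≤ ‖eml G‖ * ‖hiM‖ * ‖eml (fun r => hM * Gi r) - hM * eml Gi‖ := by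
        refine (norm_mul_le _ _).trans (mul_le_mul_of_nonneg_right (norm_mul_le _ _) (norm_nonneg _))
    _ = ‖eml (fun r => hM * Gi r) - hM * eml Gi‖ := by
        rw [CStarRing.norm_of_mem_unitary hemlG, CStarRing.norm_of_mem_unitary ((unitaryUnits _).inv_mem hh)]; ring
    _ ≤ 1024 * ‖(fun _ : Fin P.d → Fin P.L => hM) - 1‖ * ‖Gi - 1‖ := hR
    _ ≤ 1024 * ω * ω := by gcongr
    _ = 1024 * ω ^ 2 := by ring

end Unitary

/-! ## §4 The effective gauge's one-step unitarity transfer -/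

section Transfer

variable {P : Params} {j : ℕ}

/-- ★ **(P8) THE EFFECTIVE-GAUGE STEP IS UNITARY**: for `κ` unitary at the block centre `ŷ` and at the centre-stair ends `x_i` with oscillation
`‖κ(x_i)⁻¹κ(ŷ) − 1‖ ≤ 1∕4`, and `Y` with unitary centre stairs `H_i = Y(Γ_{ŷ,x_i})`, `‖H_i − 1‖ ≤ 1∕64`: `v(Y^κ)(y)⁻¹·κ(ŷ)·v(Y)(y)` is unitary — `v(Y)(y) = eml{H_i}` and
`v(Y^κ)(y) = κ(ŷ)·eml{H_i·κ(x_i)⁻¹κ(ŷ)}·κ(ŷ)⁻¹` are `exp[mean log]`s of unitary families within `1∕3` of `1` (✓`eml_mem_unitaryGroup`).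
[cite: Balaban1985Averaging, (97)-(100) p.32, (110) p.34; Balaban1987RG1, (0.9) p.253] -/
theorem effGaugeStep_mem_unitaryUnits (u : GaugeTransf P j (Matrix (Fin 2) (Fin 2) ℂ)ˣ) (W : GaugeField P j (Matrix (Fin 2) (Fin 2) ℂ)ˣ) (y : Site P (j + 1))
    (huc : u (emb y) ∈ unitaryUnits (Matrix (Fin 2) (Fin 2) ℂ))
    (hui : ∀ i : Idx P, u (walkEnd (emb y) (stairWord i.2.1 (off i.1))) ∈ unitaryUnits (Matrix (Fin 2) (Fin 2) ℂ))
    (hH : ∀ i : Idx P, ((holT W (emb y) (stairWord i.2.1 (off i.1)) : (Matrix (Fin 2) (Fin 2) ℂ)ˣ) : Matrix (Fin 2) (Fin 2) ℂ) ∈ Matrix.unitaryGroup (Fin 2) ℂ)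
    (hh : ∀ i : Idx P, ‖((holT W (emb y) (stairWord i.2.1 (off i.1)) : (Matrix (Fin 2) (Fin 2) ℂ)ˣ) : Matrix (Fin 2) (Fin 2) ℂ) - 1‖ ≤ 1 / 64)
    (he : ∀ i : Idx P, ‖((((u (walkEnd (emb y) (stairWord i.2.1 (off i.1))))⁻¹ * u (emb y)) : (Matrix (Fin 2) (Fin 2) ℂ)ˣ) : Matrix (Fin 2) (Fin 2) ℂ) - 1‖ ≤ 1 / 4) :
    (vframeU (gaugeActT u W) y)⁻¹ * u (emb y) * vframeU W y ∈ unitaryUnits (Matrix (Fin 2) (Fin 2) ℂ) := by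
  have hV : vframeU W y ∈ unitaryUnits (Matrix (Fin 2) (Fin 2) ℂ) := by
    show ((vframeU W y : (Matrix (Fin 2) (Fin 2) ℂ)ˣ) : Matrix (Fin 2) (Fin 2) ℂ) ∈ Matrix.unitaryGroup (Fin 2) ℂ
    rw [coe_vframeU]
    exact eml_mem_unitaryGroup hH (fun i => (hh i).trans (by norm_num))
  have hD : ∀ i : Idx P, ((u (walkEnd (emb y) (stairWord i.2.1 (off i.1))))⁻¹ * u (emb y)) ∈ unitaryUnits (Matrix (Fin 2) (Fin 2) ℂ) :=
    fun i => (unitaryUnits _).mul_mem ((unitaryUnits _).inv_mem (hui i)) huc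
  have hfamU : ∀ i : Idx P, ((holT W (emb y) (stairWord i.2.1 (off i.1)) : (Matrix (Fin 2) (Fin 2) ℂ)ˣ) : Matrix (Fin 2) (Fin 2) ℂ) *
      ((((u (walkEnd (emb y) (stairWord i.2.1 (off i.1))))⁻¹ * u (emb y)) : (Matrix (Fin 2) (Fin 2) ℂ)ˣ) : Matrix (Fin 2) (Fin 2) ℂ) ∈ Matrix.unitaryGroup (Fin 2) ℂ :=
    fun i => Submonoid.mul_mem _ (hH i) (hD i)
  have hfam1 : ∀ i : Idx P, ‖((holT W (emb y) (stairWord i.2.1 (off i.1)) : (Matrix (Fin 2) (Fin 2) ℂ)ˣ) : Matrix (Fin 2) (Fin 2) ℂ) *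
      ((((u (walkEnd (emb y) (stairWord i.2.1 (off i.1))))⁻¹ * u (emb y)) : (Matrix (Fin 2) (Fin 2) ℂ)ˣ) : Matrix (Fin 2) (Fin 2) ℂ) - 1‖ ≤ 1 / 3 := by
    intro i
    set H := ((holT W (emb y) (stairWord i.2.1 (off i.1)) : (Matrix (Fin 2) (Fin 2) ℂ)ˣ) : Matrix (Fin 2) (Fin 2) ℂ)
    set D := ((((u (walkEnd (emb y) (stairWord i.2.1 (off i.1))))⁻¹ * u (emb y)) : (Matrix (Fin 2) (Fin 2) ℂ)ˣ) : Matrix (Fin 2) (Fin 2) ℂ)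
    calc ‖H * D - 1‖ = ‖(H - 1) * D + (D - 1)‖ := by congr 1; noncomm_ring
      _ ≤ ‖H - 1‖ * ‖D‖ + ‖D - 1‖ := (norm_add_le _ _).trans (add_le_add (norm_mul_le _ _) le_rfl)
      _ ≤ 1 / 64 * 1 + 1 / 4 := by
          gcongr
          · exact hh i
          · exact (CStarRing.norm_of_mem_unitary (hD i)).le
          · exact he i
      _ ≤ 1 / 3 := by norm_num
  have hVκ : vframeU (gaugeActT u W) y ∈ unitaryUnits (Matrix (Fin 2) (Fin 2) ℂ) := by
    show ((vframeU (gaugeActT u W) y : (Matrix (Fin 2) (Fin 2) ℂ)ˣ) : Matrix (Fin 2) (Fin 2) ℂ) ∈ Matrix.unitaryGroup (Fin 2) ℂ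
    rw [coe_vframeU_gaugeActT_eq_conj_eml]
    exact Submonoid.mul_mem _ (Submonoid.mul_mem _ huc (eml_mem_unitaryGroup hfamU hfam1)) ((unitaryUnits _).inv_mem huc)
  exact (unitaryUnits _).mul_mem ((unitaryUnits _).mul_mem ((unitaryUnits _).inv_mem hVκ) huc) hV

end Transfer

end Summit.QuantumFields.YangMills.Theorems.HalvingEffGaugeRowGUnitary

end
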